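import Summits.CriticalPhenomena.CardyFormulaZ2.Theorems.CardyComplexConeEdgeCoherenceStubFactorisationLocal
import Summits.CriticalPhenomena.CardyFormulaZ2.Theorems.EdgeCoherence.Negative.CornerObservablePhase

/-!
# Stub `stub_factorisation` of line `Sketch` (composition `FixedRadiusCut`), crux `CardyComplexCone.EdgeCoherence`
(item stmt-CriticalPhenomena-11385) — helper module 2/4: orbit form of the integrand, interior balls

Helper file `--supports stmt-CriticalPhenomena-11385` (module 2 of 4 of the proof of `stub_factorisation`).

Contents (everything proved):
* §3 the exploration of admissible data: `startCorner E` is a start corner (`Classical.epsilon_spec` on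
  `existsUnique_startCorner`); the **orbit form of the integrand** of the corner observable
  (`dartPhaseSum_eq_sum_orbitPhase`: the phase sum at the corner `p` is `Σ_{k < len-1} [orbit k = p]·orbitPhase k`,
  from `Negative.dartPhaseSum_eq_exp_turnSign` and distinctness of orbit corners before the exit); the
  exit characterisation `t + 1 < len ↔` "the first `t+1` orbit corners have inner faces"
  (`succ_lt_length_iff`); locality of `bcBondConfig` and of `medialExploration` in the completed
  configuration (`medialExploration_inter_edgeSet`); orbit locality (`cornerOrbit_congr'`); finiteness of `E(Ω_δ)`.
* §4 geometry of a ball far inside the discrete domain, under the *interior hypothesis* "every lattice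
  edge with both endpoints within sup-distance `ρ + 2` of `v` is an edge of `Ω_δ`": faces around sites
  within `ρ + 1` are inner, such sites are off `zdBoundary`, inner–inner edges of `B(v, ρ)` are open in
  `bcBondConfig ω` iff open in `ω`, and the **status transfer** to the quenched translated configuration
  `mixCfg ρ β̃ ω̃` for every lattice edge touching the ball (`map_mem_mixCfg_iff`).

Sources: S. Smirnov, C. R. Acad. Sci. Paris 333 (2001) §2; S. Smirnov, Ann. of Math. 172 (2010) §2.2
(the phase `exp(-i σ W)` of the exploration); H. Duminil-Copin, S. Smirnov, Clay Math. Proc. 15 (2012) §8.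
-/

noncomputable section

namespace Summit.CriticalPhenomena.CardyFormulaZ2.Cruxes.EdgeCoherence.FixedRadiusCut

open scoped BigOperators Topology
open Filter Set MeasureTheory ProbabilityTheory
open Literature.Probability.LatticeModels Literature.Probability.RandomPlanarGeometry
open Literature.Probability.Percolation

/-! ## §3 The exploration of admissible data: start corner, orbit form of the integrand, exit -/

section Exploration

open Summit.CriticalPhenomena.CardyFormulaZ2.Theorems.EdgeCoherence.Negative
  (dartPhaseSum dartPhaseSum_eq_exp_turnSign dartPhaseSum_eq_zero_of_forall_ne)

variable {E : DiscreteDobrushin}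

/-- For admissible data the chosen `startCorner E` is a start corner (`existsUnique_startCorner`). -/
theorem isStartCorner_startCorner (hE : E.IsZdAdmissible) : E.IsStartCorner (startCorner E) := by
  obtain ⟨p, hp, -⟩ := DiscreteDobrushin.existsUnique_startCorner hE
  exact Classical.epsilon_spec (p := fun c => E.IsStartCorner c) ⟨p, ⟨hp.1, hp.2.1, hp.2.2⟩⟩

/-- **Orbit form of the integrand.** For admissible data with start corner `c₀` and a nonzero
reading mesh, the phase sum of the exploration at the corner coded by `p` is the sum over the
dart positions `k < len - 1` of `[orbit k = p] · orbitPhase k` (at most one term is nonzero). -/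
theorem dartPhaseSum_eq_sum_orbitPhase (hE : E.IsZdAdmissible) {c₀ : Site 2 × Fin 4}
    (hc₀ : E.IsStartCorner c₀) {δ : ℝ} (hδ : δ ≠ 0) (ω : BondConfig (Site 2)) (p : Site 2 × Fin 4) :
    dartPhaseSum (medialExploration E ω) δ p.1 (cFace p) =
      ∑ k ∈ Finset.range ((medialExploration E ω).length - 1),
        if cornerOrbit (E.bcBondConfig ω) c₀ k = p then orbitPhase (E.bcBondConfig ω) c₀ k else 0 := by
  by_cases h : ∃ k₀, k₀ + 1 < (medialExploration E ω).length ∧ cornerOrbit (E.bcBondConfig ω) c₀ k₀ = p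
  · obtain ⟨k₀, hk₀, horb⟩ := h
    rw [dartPhaseSum_eq_exp_turnSign hE hc₀ ω hδ p k₀ hk₀ horb, eq_comm, Finset.sum_eq_single k₀]
    · rw [if_pos horb]; rfl
    · intro k hk hne
      rw [Finset.mem_range] at hk
      rw [if_neg]
      intro hk'
      have hγ := isMedialExploration_medialExploration_holds E hE ω
      have hinner : ∀ j < max k k₀, E.IsInnerFace (cFace (cornerOrbit (E.bcBondConfig ω) c₀ j)) :=
        fun j hj => (hγ.dart_eq hE hc₀ j (by omega)).1
      rcases lt_or_gt_of_ne hne with hlt | hlt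
      · exact cornerOrbit_ne hE hc₀ hlt (fun j hj => hinner j (by omega)) (hk'.trans horb.symm)
      · exact cornerOrbit_ne hE hc₀ hlt (fun j hj => hinner j (by omega)) (horb.trans hk'.symm)
    · intro hk₀'
      exact absurd (Finset.mem_range.2 (by omega)) hk₀'
  · push Not at h
    rw [dartPhaseSum_eq_zero_of_forall_ne hE hc₀ ω δ p fun k hk => h k hk]
    refine (Finset.sum_eq_zero fun k hk => ?_).symm
    rw [Finset.mem_range] at hk
    rw [if_neg (h k (by omega))]

/-- Darts of the exploration have inner faces. -/
theorem isInnerFace_of_succ_lt_length (hE : E.IsZdAdmissible) {c₀ : Site 2 × Fin 4}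
    (hc₀ : E.IsStartCorner c₀) (ω : BondConfig (Site 2)) {k : ℕ}
    (hk : k + 1 < (medialExploration E ω).length) :
    E.IsInnerFace (cFace (cornerOrbit (E.bcBondConfig ω) c₀ k)) :=
  ((isMedialExploration_medialExploration_holds E hE ω).dart_eq hE hc₀ k hk).1

/-- Conversely, if the orbit has inner faces at all times `≤ K`, the exploration has not ended
by then: `K + 1 < len`. -/
theorem succ_lt_length_of_forall_isInnerFace (hE : E.IsZdAdmissible) {c₀ : Site 2 × Fin 4}
    (hc₀ : E.IsStartCorner c₀) (ω : BondConfig (Site 2)) {K : ℕ}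
    (h : ∀ k ≤ K, E.IsInnerFace (cFace (cornerOrbit (E.bcBondConfig ω) c₀ k))) :
    K + 1 < (medialExploration E ω).length := by
  by_contra hle
  have hγ := isMedialExploration_medialExploration_holds E hE ω
  have h1 := hγ.one_lt_length
  exact hγ.not_isInnerFace_length hE hc₀ (h _ (by omega))

/-- `t + 1 < len` is a property of the first `t + 1` orbit corners: it says their faces are inner. -/
theorem succ_lt_length_iff (hE : E.IsZdAdmissible) {c₀ : Site 2 × Fin 4}
    (hc₀ : E.IsStartCorner c₀) (ω : BondConfig (Site 2)) (t : ℕ) :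
    t + 1 < (medialExploration E ω).length ↔
      ∀ k ≤ t, E.IsInnerFace (cFace (cornerOrbit (E.bcBondConfig ω) c₀ k)) :=
  ⟨fun h k hk => isInnerFace_of_succ_lt_length hE hc₀ ω (by omega),
    succ_lt_length_of_forall_isInnerFace hE hc₀ ω⟩

/-- The completed configuration reads `ω` only on the edges of `Ω_δ`. -/
theorem bcBondConfig_inter_edgeSet (ω : BondConfig (Site 2)) :
    E.bcBondConfig (ω ∩ (discreteDomainGraph E.Ω E.δ).edgeSet) = E.bcBondConfig ω := by
  ext e
  simp only [DiscreteDobrushin.mem_bcBondConfig_iff, Set.mem_inter_iff]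
  tauto

/-- The completed configurations of `ω` and `ω ∩ O` agree on `O`. -/
theorem mem_bcBondConfig_inter_iff {O : Set (Sym2 (Site 2))} (ω : BondConfig (Site 2))
    {e : Sym2 (Site 2)} (he : e ∈ O) : e ∈ E.bcBondConfig (ω ∩ O) ↔ e ∈ E.bcBondConfig ω := by
  simp only [DiscreteDobrushin.mem_bcBondConfig_iff, Set.mem_inter_iff]
  tauto

/-- The medial exploration reads `ω` only on the edges of `Ω_δ`: it depends on `ω` only through the
completed configuration (cf. `LagHandOff.Negative.medialExploration_congr`, not imported). -/
theorem medialExploration_inter_edgeSet (ω : BondConfig (Site 2)) :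
    medialExploration E (ω ∩ (discreteDomainGraph E.Ω E.δ).edgeSet) = medialExploration E ω := by
  have h := bcBondConfig_inter_edgeSet (E := E) ω
  have key : ∀ γ, IsMedialExploration E (ω ∩ (discreteDomainGraph E.Ω E.δ).edgeSet) γ ↔
      IsMedialExploration E ω γ := by
    intro γ
    constructor
    · rintro ⟨h1, h2, h3, h4, h5, h6, h7, h8⟩
      exact ⟨h1, h2, fun a b c habc => h ▸ h3 a b c habc, h4, h5, h6, h7, h8⟩
    · rintro ⟨h1, h2, h3, h4, h5, h6, h7, h8⟩
      exact ⟨h1, h2, fun a b c habc => h.symm ▸ h3 a b c habc, h4, h5, h6, h7, h8⟩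
  have hfun : IsMedialExploration E (ω ∩ (discreteDomainGraph E.Ω E.δ).edgeSet) =
      IsMedialExploration E ω := funext fun γ => propext (key γ)
  by_cases hex : ∃! γ, IsMedialExploration E (ω ∩ (discreteDomainGraph E.Ω E.δ).edgeSet) γ
  · have hex' : ∃! γ, IsMedialExploration E ω γ := by rwa [← hfun]
    have h1 : IsMedialExploration E (ω ∩ (discreteDomainGraph E.Ω E.δ).edgeSet)
        (medialExploration E (ω ∩ (discreteDomainGraph E.Ω E.δ).edgeSet)) := by
      unfold medialExploration; rw [dif_pos hex]; exact hex.exists.choose_spec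
    have h2 : IsMedialExploration E ω (medialExploration E ω) := by
      unfold medialExploration; rw [dif_pos hex']; exact hex'.exists.choose_spec
    exact hex.unique h1 ((key _).2 h2)
  · have hex' : ¬ ∃! γ, IsMedialExploration E ω γ := by rwa [← hfun]
    unfold medialExploration
    rw [dif_neg hex, dif_neg hex']

/-- **Orbit locality.** If two configurations agree on the target edges of the first `n` corners
of the orbit of `c` in `β`, the two orbits of `c` agree up to time `n`. -/
theorem cornerOrbit_congr' {β β' : BondConfig (Site 2)} (c : Site 2 × Fin 4) {n : ℕ}
    (h : ∀ i < n, (cTgt (cornerOrbit β c i) ∈ β' ↔ cTgt (cornerOrbit β c i) ∈ β)) :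
    ∀ i ≤ n, cornerOrbit β' c i = cornerOrbit β c i := by
  intro i hi
  induction i with
  | zero => rfl
  | succ i ih =>
    change nextCorner β' (cornerOrbit β' c i) = nextCorner β (cornerOrbit β c i)
    rw [ih (Nat.le_of_succ_le hi)]
    have key := h i hi
    by_cases h2 : cTgt (cornerOrbit β c i) ∈ β
    · rw [nextCorner_of_mem h2, nextCorner_of_mem (key.2 h2)]
    · rw [nextCorner_of_not_mem h2, nextCorner_of_not_mem (fun h1 => h2 (key.1 h1))]

/-- The edge set of `Ω_δ` is finite for admissible data. -/
theorem edgeSet_finite (hE : E.IsZdAdmissible) : (discreteDomainGraph E.Ω E.δ).edgeSet.Finite := by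
  have hfin := meshDomain_finite hE.isBounded hE.delta_pos
  refine ((hfin.prod hfin).image fun xy : Site 2 × Site 2 => s(xy.1, xy.2)).subset ?_
  intro e he
  induction e using Sym2.ind with
  | h x y =>
    rw [SimpleGraph.mem_edgeSet] at he
    have h := discreteDomainGraph_adj_iff.1 he
    exact ⟨(x, y), ⟨h.2.1, h.2.2⟩, rfl⟩

end Exploration

/-! ## §4 Geometry: balls far inside the discrete domain -/

section Geometry

variable {E : DiscreteDobrushin} {v : Site 2} {ρ : ℕ}

/-- Coordinates of the face offsets are `0` or `1`. -/
theorem cornerOff_apply_eq (k : Fin 4) (i : Fin 2) : cornerOff k i = 0 ∨ cornerOff k i = 1 := by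
  fin_cases k <;> fin_cases i <;> simp [cornerOff]

/-- Coordinates of the unit vectors are `-1`, `0` or `1`. -/
theorem abs_cornerUnit_apply_le (k : Fin 4) (i : Fin 2) : |cornerUnit k i| ≤ 1 := by
  fin_cases k <;> fin_cases i <;> simp [cornerUnit]

/-- Lattice neighbours differ by at most one in every coordinate. -/
theorem abs_sub_le_one_of_adj {a b : Site 2} (h : (zdGraph 2).Adj a b) (i : Fin 2) : |b i - a i| ≤ 1 := by
  obtain ⟨k, rfl⟩ := exists_eq_add_cornerUnit h
  simpa using abs_cornerUnit_apply_le k i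

/-- A corner of a face around `x` is within sup-distance one of `x`. -/
theorem abs_sub_le_one_of_isCorner_faceAt {x a : Site 2} {k : Fin 4} (h : IsCorner a (faceAt x k))
    (i : Fin 2) : |a i - x i| ≤ 1 := by
  have hk := cornerOff_apply_eq k i
  have ha := h i
  simp only [faceAt, Pi.sub_apply] at ha
  rw [abs_le]
  constructor <;> omega

/-- **Interior hypothesis.** `Interior E v ρ`-style statement used below, spelled out: every
lattice edge with both endpoints within sup-distance `ρ + 2` of `v` is an edge of `Ω_δ`. Under it,
every face around a site within sup-distance `ρ + 1` of `v` is inner. -/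
theorem isInnerFace_of_interior
    (hgeo : ∀ x y : Site 2, (∀ i, |x i - v i| ≤ ρ + 2) → (∀ i, |y i - v i| ≤ ρ + 2) →
      (zdGraph 2).Adj x y → (discreteDomainGraph E.Ω E.δ).Adj x y)
    {x : Site 2} (hx : ∀ i, |x i - v i| ≤ ρ + 1) (k : Fin 4) : E.IsInnerFace (faceAt x k) := by
  intro a b ha hb hab
  refine hgeo a b (fun i => ?_) (fun i => ?_) hab
  · have h1 := abs_sub_le_one_of_isCorner_faceAt ha i
    have h2 := hx i
    rw [abs_le] at h1 h2 ⊢; constructor <;> omega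
  · have h1 := abs_sub_le_one_of_isCorner_faceAt hb i
    have h2 := hx i
    rw [abs_le] at h1 h2 ⊢; constructor <;> omega

/-- Under the interior hypothesis, no site within sup-distance `ρ + 1` of `v` lies on the
square-lattice discrete boundary `zdBoundary`. -/
theorem not_mem_zdBoundary_of_interior
    (hgeo : ∀ x y : Site 2, (∀ i, |x i - v i| ≤ ρ + 2) → (∀ i, |y i - v i| ≤ ρ + 2) →
      (zdGraph 2).Adj x y → (discreteDomainGraph E.Ω E.δ).Adj x y)
    {x : Site 2} (hx : ∀ i, |x i - v i| ≤ ρ + 1) : x ∉ E.zdBoundary := by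
  rintro (⟨-, y, hxy, hne⟩ | ⟨y, -, -, f, hf, hxf, -⟩)
  · refine hne (hgeo x y (fun i => ?_) (fun i => ?_) hxy)
    · have h2 := hx i
      rw [abs_le] at h2 ⊢; constructor <;> omega
    · have h1 := abs_sub_le_one_of_adj hxy i
      have h2 := hx i
      rw [abs_le] at h1 h2 ⊢; constructor <;> omega
  · obtain ⟨k, rfl⟩ := exists_faceAt_of_isCorner hxf
    exact hf (isInnerFace_of_interior hgeo hx k)

/-- A point of `B(v, ρ)` is within sup-distance `ρ` of `v` (coordinate form). -/
theorem abs_sub_le_of_inBall {x : Site 2} (h : InBall ρ (x - v)) (i : Fin 2) : |x i - v i| ≤ ρ := by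
  simpa using abs_le_of_inBall h i

/-- Under the interior hypothesis, an inner–inner lattice edge of the ball `B(v, ρ)` is open in
the completed configuration iff it is open in `ω`. -/
theorem mem_bcBondConfig_iff_of_inBall
    (hgeo : ∀ x y : Site 2, (∀ i, |x i - v i| ≤ ρ + 2) → (∀ i, |y i - v i| ≤ ρ + 2) →
      (zdGraph 2).Adj x y → (discreteDomainGraph E.Ω E.δ).Adj x y)
    (ω : BondConfig (Site 2)) {a b : Site 2} (hab : (zdGraph 2).Adj a b) (ha : InBall ρ (a - v))
    (hb : InBall ρ (b - v)) : s(a, b) ∈ E.bcBondConfig ω ↔ s(a, b) ∈ ω := by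
  have ha' : ∀ i, |a i - v i| ≤ ρ + 1 := fun i => by
    have := abs_sub_le_of_inBall ha i; rw [abs_le] at this ⊢; constructor <;> omega
  have hb' : ∀ i, |b i - v i| ≤ ρ + 1 := fun i => by
    have := abs_sub_le_of_inBall hb i; rw [abs_le] at this ⊢; constructor <;> omega
  have hedge : (discreteDomainGraph E.Ω E.δ).Adj a b :=
    hgeo a b (fun i => by have := ha' i; rw [abs_le] at this ⊢; constructor <;> omega)
      (fun i => by have := hb' i; rw [abs_le] at this ⊢; constructor <;> omega) hab
  have haA : a ∉ E.zdArcA := fun h => not_mem_zdBoundary_of_interior hgeo ha' (E.zdArcA_subset_zdBoundary h)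
  have haB : a ∉ E.zdArcB := fun h => not_mem_zdBoundary_of_interior hgeo ha' (E.zdArcB_subset_zdBoundary h)
  have hbB : b ∉ E.zdArcB := fun h => not_mem_zdBoundary_of_interior hgeo hb' (E.zdArcB_subset_zdBoundary h)
  rw [DiscreteDobrushin.mem_bcBondConfig_iff]
  constructor
  · rintro ⟨-, hA | ⟨hω, -⟩⟩
    · exact absurd (hA a (Sym2.mem_mk_left _ _)) haA
    · exact hω
  · intro hω
    refine ⟨hedge, Or.inr ⟨hω, fun x hx => ?_⟩⟩
    rcases Sym2.mem_iff.1 hx with rfl | rfl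
    · exact haB
    · exact hbB

/-- `∀` over the two members of a pair. -/
theorem forall_mem_pair {P : Site 2 → Prop} {a b : Site 2} :
    (∀ x ∈ (s(a, b) : Sym2 (Site 2)), P x) ↔ P a ∧ P b :=
  ⟨fun h => ⟨h a (Sym2.mem_mk_left a b), h b (Sym2.mem_mk_right a b)⟩,
    fun h _ hx => (Sym2.mem_iff.1 hx).elim (fun e => e ▸ h.1) fun e => e ▸ h.2⟩

/-- `∃` over the two members of a pair. -/
theorem exists_mem_pair {P : Site 2 → Prop} {a b : Site 2} :
    (∃ x ∈ (s(a, b) : Sym2 (Site 2)), P x) ↔ P a ∨ P b :=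
  ⟨fun ⟨_, hx, h⟩ => (Sym2.mem_iff.1 hx).elim (fun e => Or.inl (e ▸ h)) fun e => Or.inr (e ▸ h),
    fun h => h.elim (fun h => ⟨a, Sym2.mem_mk_left a b, h⟩) fun h => ⟨b, Sym2.mem_mk_right a b, h⟩⟩

/-- Membership in the cut set of the ball, for an explicit pair. -/
theorem mk_mem_cutEdgesAt_iff {a b : Site 2} :
    s(a, b) ∈ cutEdgesAt ρ v ↔
      (InBall ρ (a - v) ∨ InBall ρ (b - v)) ∧ (¬ InBall ρ (a - v) ∨ ¬ InBall ρ (b - v)) := by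
  show ((∃ x ∈ (s(a, b) : Sym2 (Site 2)), InBall ρ (x - v)) ∧
      ∃ y ∈ (s(a, b) : Sym2 (Site 2)), ¬ InBall ρ (y - v)) ↔ _
  rw [exists_mem_pair, exists_mem_pair]

/-- Membership in the quenched configuration, unfolded. -/
theorem mem_mixCfg_iff {B W : BondConfig (Site 2)} {e : Sym2 (Site 2)} :
    e ∈ mixCfg ρ B W ↔ (e ∈ W ∧ ∀ x ∈ e, InBall ρ x) ∨ (e ∈ B ∧ ∃ x ∈ e, ¬ InBall ρ x) :=
  Iff.rfl

/-- **Status transfer to the quenched inner configuration.** Under the interior hypothesis, for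
every lattice edge `s(a, b)` touching the ball `B(v, ρ)`, its translate by `-v` is open in
`mixCfg ρ β̃ ω̃` — with `β̃` the translated cut-crossing pattern of `β = E.bcBondConfig ω` and `ω̃`
the translated configuration — iff it is open in `β`. -/
theorem map_mem_mixCfg_iff
    (hgeo : ∀ x y : Site 2, (∀ i, |x i - v i| ≤ ρ + 2) → (∀ i, |y i - v i| ≤ ρ + 2) →
      (zdGraph 2).Adj x y → (discreteDomainGraph E.Ω E.δ).Adj x y)
    (ω : BondConfig (Site 2)) {a b : Site 2} (hab : (zdGraph 2).Adj a b)
    (htouch : InBall ρ (a - v) ∨ InBall ρ (b - v)) :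
    (s(a, b) : Sym2 (Site 2)).map (· - v) ∈
        mixCfg ρ ((fun e : Sym2 (Site 2) => e.map (· - v)) '' (E.bcBondConfig ω ∩ cutEdgesAt ρ v))
          (BondConfig.relabel (sym2Equiv (Site.shift (-v))) ω) ↔
      s(a, b) ∈ E.bcBondConfig ω := by
  have hinj : Function.Injective fun e : Sym2 (Site 2) => e.map (· - v) :=
    Sym2.map.injective sub_left_injective
  have himg : (s(a, b) : Sym2 (Site 2)).map (· - v) ∈
      (fun e : Sym2 (Site 2) => e.map (· - v)) '' (E.bcBondConfig ω ∩ cutEdgesAt ρ v) ↔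
      s(a, b) ∈ E.bcBondConfig ω ∩ cutEdgesAt ρ v :=
    hinj.mem_set_image (f := fun e : Sym2 (Site 2) => e.map (· - v)) (a := s(a, b))
  have hω : (s(a - v, b - v) : Sym2 (Site 2)) ∈ BondConfig.relabel (sym2Equiv (Site.shift (-v))) ω ↔
      s(a, b) ∈ ω := by
    rw [sub_eq_add_neg, sub_eq_add_neg]
    exact mk_add_mem_relabel_shift_iff (-v) ω a b
  rw [mem_mixCfg_iff, himg, Sym2.map_mk, hω, forall_mem_pair, exists_mem_pair, Set.mem_inter_iff,
    mk_mem_cutEdgesAt_iff]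
  by_cases ha : InBall ρ (a - v) <;> by_cases hb : InBall ρ (b - v)
  · rw [mem_bcBondConfig_iff_of_inBall hgeo ω hab ha hb]; tauto
  · tauto
  · tauto
  · exact absurd htouch (by tauto)

end Geometry

/-! ## Registered glue sub-goal of this module -/

/-- **Glue sub-goal `dartPhaseSum_orbit_form`** (registered on stmt-CriticalPhenomena-11385 for this
helper module): the orbit form of the integrand of the corner observable — for admissible data and a
nonzero reading mesh, the phase sum of the exploration at the corner coded by `p` is
`Σ_{k < len-1} [orbit k = p] · orbitPhase k` along the orbit from `startCorner E`. -/
theorem dartPhaseSum_orbit_form : ∀ (E : DiscreteDobrushin), E.IsZdAdmissible → ∀ (δ : ℝ), δ ≠ 0 → ∀ (ω : BondConfig (Site 2)) (p : Site 2 × Fin 4), Summit.CriticalPhenomena.CardyFormulaZ2.Theorems.EdgeCoherence.Negative.dartPhaseSum (medialExploration E ω) δ p.1 (cFace p) = ∑ k ∈ Finset.range ((medialExploration E ω).length - 1), if cornerOrbit (E.bcBondConfig ω) (startCorner E) k = p then orbitPhase (E.bcBondConfig ω) (startCorner E) k else 0 :=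
  fun _ hE _ hδ ω p => dartPhaseSum_eq_sum_orbitPhase hE (isStartCorner_startCorner hE) hδ ω p

end Summit.CriticalPhenomena.CardyFormulaZ2.Cruxes.EdgeCoherence.FixedRadiusCut

end
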